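import Literature.Computability.Complexity.MurrayWilliams2018Lemma13
import Literature.Computability.Complexity.NSUBEXPGuardedBall
import Literature.Computability.Complexity.FinitePatching
import HarnessLib

/-!
# Patching verifiers on short inputs; `NTIME t` is closed under finite variants for time-constructible `t`

Literature / complexity toolkit (machine constructions for the tree's one-constant verifier
form of `NTIME`, `Nondeterministic.lean`). Arguments "almost everywhere in the input length" —
the eventual form of witness circuits (`HasWitnessCircuits`, `MurrayWilliams2018EasyWitness.lean`:
small witnesses for all `x ∈ L` with `|x| ≥ n₀`), the simulation hypotheses of Murray–Williams'
Theorem 1.2 (`MurrayWilliams2018Hierarchy.lean`, `MurrayWilliams2018LevelSimulation.lean`), the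
easy witness method in general — end with a verifier that is correct on all inputs of length
`≥ n₀` and must be PATCHED below `n₀` by a hard-wired table (Arora–Barak 2009, §1.3 and §6.2:
finitely many inputs are handled in the finite control; Murray–Williams 2018, §5). For `FP` the
tree has `mem_FP_of_eqOn_le` (`FinitePatching.lean`); this file does it for verifiers:

* `Patch.dispatchT n₀ tab` — the finite-state transducer (`Transducers.lean`) on pair words
  `⟨x, y⟩ = boolPair x y` with the state dynamics of the patching transducer `Patch.patchT`
  (it stores the first `n₀` bits of `x`) that COPIES its input and, at the end, either discards
  the copy and outputs the flagged table value `0 (tab x)` (if `|x| < n₀`) or outputs the flagged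
  copy `1 ⟨x, y⟩` (if `|x| ≥ n₀`); `Patch.dispatchT_eval_boolPair`; its machine runs in time
  `2 |w| + 3` (`Patch.exists_outputsWithin_dispatchT`);
* **`exists_dispatch_machine`** — followed by the flag wrapper `flagAux M' ans`
  (`NSUBEXPGuardedBall.lean` / `TM2Lift.flagTM`: `0 b ↦ ans b`, `1 l ↦ M'(l)`): a machine that
  answers `ans (tab x)` on `⟨x, y⟩` with `|x| < n₀` within `2 |⟨x, y⟩| + 5` steps and otherwise
  behaves as `M'` with an overhead of `2 |⟨x, y⟩| + 4` steps — the form in which a bespoke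
  verifier construction absorbs its short inputs;
* **`mem_NTIME_of_eqOn_of_clocks`**, **`mem_NTIME_of_eqOn`** — if `L' ∈ NTIME t`, `L` agrees
  with `L'` on all words of length `≥ n₀`, and the admissible witness lengths `c · t + c` have
  unary clocks in time `O(t)` (in particular if `t` is time constructible,
  `exists_unaryClock_of_timeConstructible`), then `L ∈ NTIME t`. The new verifier is
  `truncMapAux (clock) ▸ dispatch ▸ flag (old machine)`: the certificate is first CUT at the old
  admissible length (`TruncMapMachine.lean`; the new constant is larger, so longer certificates
  become admissible, on which the old machine is unspecified — the reason the clock is needed and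
  the statement is not available for arbitrary `t`, exactly as for `NTIME_mono`), then short
  inputs are answered by the table `x ↦ [x ∈ L]` and long ones by the old machine.

No named fact is introduced; the only definition is the transducer `Patch.dispatchT`.

## References

* S. Arora, B. Barak, *Computational Complexity: A Modern Approach*, CUP 2009, §1.3 (machine
  constructions; hard-wiring finitely many inputs), Def. 2.1 and §2.1.2 (verifier form of
  `NTIME`), §6.2 [AroraBarak2009].
* C. D. Murray, R. R. Williams, *Circuit lower bounds for nondeterministic quasi-polytime: an easy
  witness lemma for NP and NQP*, STOC 2018, §2 and §5 (witness circuits for all but finitely many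
  input lengths) [MurrayWilliams2018].
* J. E. Hopcroft, J. D. Ullman, *Introduction to Automata Theory, Languages, and Computation*,
  1979, §2.7 (Mealy machines).
-/

namespace Literature.Computability.Complexity

open _root_.Computability Turing Filter StrCopy

namespace Patch

variable (n₀ : ℕ) (tab : List Bool → Bool)

/-- **The dispatching transducer.** State dynamics of the patching transducer `patchT n₀`
(reading the doubled first component of a pair word, it stores its first `n₀` bits; the
separator switches to the copying phase); unlike `patchT` it emits EVERY input symbol. At the
end: if fewer than `n₀` bits were stored (`|x| < n₀`) it discards the body and outputs the
flagged table value `[0, tab x]`; otherwise it outputs the flag `1` in front of the body.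
[Hopcroft–Ullman 1979, §2.7] [folklore] -/
def dispatchT : FST (PState n₀) Bool Bool where
  init := ⟨false, none, 0, fun _ => false⟩
  step s a := (((patchT n₀ fun _ => ([] : List Bool)).step s a).1, [a])
  front s := if (s.cnt : ℕ) < n₀ then [false, tab s.pref] else [true]
  keep s := decide ((s.cnt : ℕ) = n₀)

variable {n₀ tab}

/-- **Running the dispatching transducer**: the state is that of `patchT`, the emitted body is
the input read so far. [folklore] -/
theorem run_dispatchT (w : List Bool) : ∀ s : PState n₀,
    ((dispatchT n₀ tab).run s w).1 = ((patchT n₀ fun _ => ([] : List Bool)).run s w).1 ∧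
      ((dispatchT n₀ tab).run s w).2 = w := by
  induction w with
  | nil => intro s; exact ⟨rfl, rfl⟩
  | cons a w ih =>
    intro s
    obtain ⟨h1, h2⟩ := ih (((patchT n₀ fun _ => ([] : List Bool)).step s a).1)
    refine ⟨?_, ?_⟩
    · rw [FST.run_cons, FST.run_cons]
      exact h1
    · rw [FST.run_cons]
      show [a] ++ ((dispatchT n₀ tab).run
        (((patchT n₀ fun _ => ([] : List Bool)).step s a).1) w).2 = a :: w
      rw [h2]
      rfl

/-- **The dispatching transducer on a pair word**: `⟨x, y⟩ ↦ 0 (tab x)` if `|x| < n₀`, and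
`⟨x, y⟩ ↦ 1 ⟨x, y⟩` otherwise. [Hopcroft–Ullman 1979, §2.7] [folklore] -/
theorem dispatchT_eval_boolPair (x y : List Bool) :
    (dispatchT n₀ tab).eval (boolPair x y) =
      if x.length < n₀ then [false, tab x] else true :: boolPair x y := by
  set P := patchT n₀ (fun _ => ([] : List Bool)) with hP
  obtain ⟨hst, hbody⟩ := run_dispatchT (tab := tab) (boolPair x y) (dispatchT n₀ tab).init
  have hinit : (dispatchT n₀ tab).init = P.init := rfl
  rw [FST.eval, hbody, hst, hinit, boolPair_eq_dup, FST.run_append]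
  obtain ⟨-, h2, h3, h4, h5⟩ := run_dup (g := fun _ => ([] : List Bool)) x P.init rfl rfl
  set s₁ := (P.run P.init (dup x)).1 with hs₁
  have e1 : P.step s₁ false = ({ s₁ with pend := some false }, []) := by
    simp [hP, patchT, h2, h3]
  have e2 : P.step { s₁ with pend := some false } true =
      ({ s₁ with phase := true, pend := none }, []) := by
    simp [hP, patchT, h2]
  have hsep : (P.run s₁ (false :: true :: y)).1 = { s₁ with phase := true, pend := none } := by
    simp only [FST.run_cons, e1, e2]
    rw [run_copy _ rfl]
  rw [hsep]
  have h0 : (P.init.cnt : ℕ) = 0 := rfl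
  have hp0 : P.init.pref = [] := by simp [PState.pref, hP, patchT]
  simp only [h0, Nat.zero_add, hp0, List.nil_append] at h4 h5
  change (if ((s₁.cnt : ℕ) < n₀) then [false, tab s₁.pref] else [true]) ++
      (if decide ((s₁.cnt : ℕ) = n₀) = true then dup x ++ false :: true :: y else []) = _
  by_cases hx : x.length < n₀
  · rw [if_pos hx, if_pos (by rw [h4]; omega), h5 hx.le, if_neg (by rw [h4]; simp; omega),
      List.append_nil]
  · rw [if_neg hx, if_neg (by rw [h4]; omega), if_pos (by rw [h4]; simp; omega)]
    rfl

/-- The dispatching transducer emits one symbol per input symbol: `maxEmit ≤ 1`. [folklore] -/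
theorem maxEmit_dispatchT_le : (dispatchT n₀ tab).maxEmit ≤ 1 :=
  Finset.sup_le fun p _ => by simp [dispatchT]

/-- **A linear-time machine for the dispatching transduction**: time `2 |w| + 3`
(`FST.timeComputable_eval`). [folklore] -/
theorem exists_outputsWithin_dispatchT (n₀ : ℕ) (tab : List Bool → Bool) :
    ∃ D : TM2ComputableAux Bool Bool, ∀ w : List Bool,
      D.OutputsWithin w ((dispatchT n₀ tab).eval w) (2 * w.length + 3) := by
  obtain ⟨D, hD⟩ := (dispatchT n₀ tab).timeComputable_eval
  refine ⟨D, fun w => (hD w).mono ?_⟩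
  have hme := maxEmit_dispatchT_le (n₀ := n₀) (tab := tab)
  show ((dispatchT n₀ tab).maxEmit + 1) * w.length + 3 ≤ 2 * w.length + 3
  exact Nat.add_le_add_right (Nat.mul_le_mul_right _ (by omega)) 3

end Patch

/-! ### The dispatching machine -/

/-- **Short inputs by table, long inputs by the given machine.** For every threshold `n₀`,
table `tab`, answer words `ans` and machine `M'` there is a machine `M` on pair words such that:
on `⟨x, y⟩` with `|x| < n₀` it outputs `ans (tab x)` within `2 |⟨x, y⟩| + 5` steps (whatever
`y`); on `⟨x, y⟩` with `|x| ≥ n₀` it outputs what `M'` outputs, `2 |⟨x, y⟩| + 4` steps later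
(the dispatching transducer followed by the flag wrapper `flagAux M' ans`). This is the device
by which a verifier correct on all long inputs absorbs the finitely many short ones
(Arora–Barak 2009, §1.3). [cite: AroraBarak2009, §1.3] -/
theorem exists_dispatch_machine (n₀ : ℕ) (tab : List Bool → Bool) (ans : Bool → List Bool)
    (M' : TM2ComputableAux Bool Bool) :
    ∃ M : TM2ComputableAux Bool Bool,
      (∀ x y : List Bool, x.length < n₀ →
        M.OutputsWithin (boolPair x y) (ans (tab x)) (2 * (boolPair x y).length + 5)) ∧
      (∀ (x y l' : List Bool) (m : ℕ), n₀ ≤ x.length → M'.OutputsWithin (boolPair x y) l' m →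
        M.OutputsWithin (boolPair x y) l' (m + 2 * (boolPair x y).length + 4)) := by
  obtain ⟨D, hD⟩ := Patch.exists_outputsWithin_dispatchT n₀ tab
  refine ⟨D.comp (flagAux M' ans), fun x y hx => ?_, fun x y l' m hx h => ?_⟩
  · have h₁ := hD (boolPair x y)
    rw [Patch.dispatchT_eval_boolPair, if_pos hx] at h₁
    have h := TM2ComputableAux.comp_outputsWithin _ _ h₁
      (flagAux_outputsWithin_answer M' ans (tab x))
    exact h.mono (by omega)
  · have h₁ := hD (boolPair x y)
    rw [Patch.dispatchT_eval_boolPair, if_neg (by omega)] at h₁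
    have h := TM2ComputableAux.comp_outputsWithin _ _ h₁ (flagAux_outputsWithin_run M' ans h)
    exact h.mono (by omega)

/-! ### `NTIME t` is closed under finite variants, along clocks -/

/-- **`NTIME t` is closed under finite variants, along clocks.** If `L' ∈ NTIME t`, `L` and `L'`
agree on all words of length `≥ n₀`, and for every `c ≥ 1` some machine produces
`⟨x, 1^{c · t |x| + c}⟩` within `a · t |x| + a` steps for an `a` with `c · t n + c ≤ a · t n + a`
and `n ≤ a · t n + a`, then `L ∈ NTIME t`. The verifier: the truncating wrapper of the clock
(`truncMapAux`, cutting the certificate at the old admissible length `c · t |x| + c`, the rest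
being read two symbols per step), then `exists_dispatch_machine` over the old machine with the
table `x ↦ [x ∈ L]`; relation `R x y = [x ∈ L]` for `|x| < n₀` and `V.rel x (y ↾ (c · t |x| + c))`
otherwise; constant `30 a + 40`. (Arora–Barak 2009, §1.3: finitely many inputs in the finite
control; §2.1.2: the verifier ignores the part of the certificate beyond its bound.)
[cite: AroraBarak2009, §1.3 and §2.1.2] -/
theorem mem_NTIME_of_eqOn_of_clocks {t : ℕ → ℕ} {L L' : Language Bool} (hL' : L' ∈ NTIME t)
    (n₀ : ℕ) (hLL' : ∀ x : List Bool, n₀ ≤ x.length → (x ∈ L ↔ x ∈ L'))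
    (hcl : ∀ c : ℕ, 1 ≤ c → ∃ (N : TM2ComputableAux Bool Bool) (a : ℕ),
      (∀ x : List Bool, N.OutputsWithin x
        (boolPair x (List.replicate (c * t x.length + c) true)) (a * t x.length + a)) ∧
      (∀ n, c * t n + c ≤ a * t n + a) ∧ (∀ n, n ≤ a * t n + a)) :
    L ∈ NTIME t := by
  classical
  obtain ⟨V⟩ := mem_NTIME_iff_nonempty_nVerifier.1 hL'
  rcases Nat.eq_zero_or_pos V.c with hc | hc
  · have h0 := V.outputsWithin [] [] (by simp)
    rw [hc] at h0
    exact (not_outputsWithin_zero V.machine _ _ (by simpa using h0)).elim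
  obtain ⟨N, a, hN, hw, hx⟩ := hcl V.c hc
  obtain ⟨M, hMs, hMl⟩ :=
    exists_dispatch_machine n₀ (fun x => L.boolIndicator x) encodeBool V.machine
  refine ⟨30 * a + 40,
    fun x y => if x.length < n₀ then L.boolIndicator x
      else V.rel x (y.take (V.c * t x.length + V.c)),
    (truncMapAux N).comp M, fun x y hy => ?_, fun x => ?_⟩
  · -- running time on an admissible pair
    have h₁ := outputsWithin_truncMapAux_boolPair N (y := y) (hN x)
    simp only [List.length_replicate] at h₁
    have hy'l : (y.take (V.c * t x.length + V.c)).length ≤ V.c * t x.length + V.c :=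
      List.length_take_le _ _
    have hlen : (boolPair x (y.take (V.c * t x.length + V.c))).length =
        2 * x.length + 2 + (y.take (V.c * t x.length + V.c)).length := length_boolPair _ _
    have hwn := hw x.length
    have hxn := hx x.length
    by_cases hxs : x.length < n₀
    · have h₂ := hMs x (y.take (V.c * t x.length + V.c)) hxs
      have h := TM2ComputableAux.comp_outputsWithin _ _ h₁ h₂
      dsimp only
      rw [if_pos hxs]
      refine h.mono ?_
      rw [hlen]
      set n := x.length with hn
      set T := t n with hT
      set Y := (y.take (V.c * T + V.c)).length with hY
      have e2 : (30 * a + 40) * T = 30 * (a * T) + 40 * T := by ring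
      omega
    · have hV := V.outputsWithin x (y.take (V.c * t x.length + V.c)) hy'l
      have h₂ := hMl x (y.take (V.c * t x.length + V.c)) _ _ (by omega) hV
      have h := TM2ComputableAux.comp_outputsWithin _ _ h₁ h₂
      dsimp only
      rw [if_neg hxs]
      refine h.mono ?_
      rw [hlen]
      set n := x.length with hn
      set T := t n with hT
      set Y := (y.take (V.c * T + V.c)).length with hY
      have e2 : (30 * a + 40) * T = 30 * (a * T) + 40 * T := by ring
      omega
  · -- correctness
    dsimp only
    by_cases hxs : x.length < n₀
    · simp only [if_pos hxs]
      have hiff : x ∈ L ↔ L.boolIndicator x = true :=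
        Set.mem_iff_boolIndicator (L : Set (List Bool)) x
      exact ⟨fun h => ⟨[], Nat.zero_le _, hiff.1 h⟩, fun ⟨_, _, h⟩ => hiff.2 h⟩
    · simp only [if_neg hxs]
      rw [hLL' x (by omega), V.mem_iff x]
      set n := x.length with hn
      constructor
      · rintro ⟨y, hy, hR⟩
        refine ⟨y, ?_, ?_⟩
        · have hwn := hw n
          have e2 : (30 * a + 40) * t n = 30 * (a * t n) + 40 * t n := by ring
          omega
        · rwa [List.take_of_length_le hy]
      · rintro ⟨y, -, hR⟩
        exact ⟨_, List.length_take_le _ _, hR⟩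

/-- **`NTIME t` is closed under finite variants for time-constructible `t`**: if `L' ∈ NTIME t`
and `L` agrees with `L'` on all words of length `≥ n₀`, then `L ∈ NTIME t`
(`mem_NTIME_of_eqOn_of_clocks` with the unary clocks of the time-constructible functions
`c · t + c`, `exists_unaryClock_of_timeConstructible`, `IsTimeConstructible.mul_add`). In
particular a verifier that is correct on all but finitely many input lengths puts its language in
`NTIME t`. [cite: AroraBarak2009, §1.3 and §2.1.2] -/
theorem mem_NTIME_of_eqOn {t : ℕ → ℕ} (ht : IsTimeConstructible t) {L L' : Language Bool}
    (hL' : L' ∈ NTIME t) (n₀ : ℕ) (hLL' : ∀ x : List Bool, n₀ ≤ x.length → (x ∈ L ↔ x ∈ L')) :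
    L ∈ NTIME t := by
  refine mem_NTIME_of_eqOn_of_clocks hL' n₀ hLL' fun c hc => ?_
  obtain ⟨N, a, hN⟩ := exists_unaryClock_of_timeConstructible (ht.mul_add hc)
  refine ⟨N, a * c + (a * c + a) + c + 1, fun x => (hN x).mono ?_, fun n => ?_, fun n => ?_⟩
  · calc a * (c * t x.length + c) + a = (a * c) * t x.length + (a * c + a) := by ring
      _ ≤ _ := Nat.add_le_add (Nat.mul_le_mul_right _ (by omega)) (by omega)
  · exact Nat.add_le_add (Nat.mul_le_mul_right _ (by omega)) (by omega)
  · calc n ≤ t n := ht.1 n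
      _ ≤ _ := (Nat.le_mul_of_pos_left _ (by omega)).trans (Nat.le_add_right _ _)

/-- **Finite modifications**: if `L' ∈ NTIME t` with `t` time constructible and `L`, `L'`
differ on finitely many words only, then `L ∈ NTIME t`. [cite: AroraBarak2009, §1.3 and §2.1.2] -/
theorem mem_NTIME_of_finite_ne {t : ℕ → ℕ} (ht : IsTimeConstructible t)
    {L L' : Language Bool} (hL' : L' ∈ NTIME t)
    (hfin : Set.Finite {x : List Bool | ¬ (x ∈ L ↔ x ∈ L')}) : L ∈ NTIME t := by
  obtain ⟨n₀, hn₀⟩ := (hfin.image List.length).bddAbove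
  refine mem_NTIME_of_eqOn ht hL' (n₀ + 1) fun x hx => ?_
  by_contra h
  have hmem : x ∈ {x : List Bool | ¬ (x ∈ L ↔ x ∈ L')} := h
  have := hn₀ ⟨x, hmem, rfl⟩
  omega

end Literature.Computability.Complexity
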